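import Summits.CriticalPhenomena.PercolationContinuityZ3.Theorems.AdditiveGluing.Negative.CertWeighted
import Literature.Probability.Percolation.SharpnessDCTProofs
import HarnessLib

/-!
# `NoHeavyLowerTail` (stmt-CriticalPhenomena-4575): the PORT-SELECTION bound with constant `2` (PI(2) / TOP2) is FALSE —
# an exact eleven-vertex near-one witness (lemma factory #6, gen 9)

`noHeavyLowerTail_of_portSelection` (`…PortSelection.lean`) and `noHeavyLowerTail_of_topTwoSelection` (`…TopTwoSelection.lean`)
reduce the crux to the hypothesis that some Kozma–Nitzan-valid selection `c(V₀)` of one relay per relay-free cluster class `V₀ ∋ o`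
satisfies `Σ_{V₀} μ(o ↔ A ∧ c(V₀) light ∧ Blob V₀) ≤ C · max_a μ(a light)` with a k-uniform constant (`C = 2` conjectured sharp:
ttrl census 0 violations / 5·10⁷).  This file proves that hypothesis FALSE at `C = 2`: on the 'alternating conduit chain' (observer `0`;
Steiner path `1–2–3`; relay `4` = hub/blocker glued to `1` and `3`; pocket relay `5` glued to `0`; carrier `6` glued to `2` with a hair to `1`;
loose port `7` on `3`; 11 weighted edges, `k = 4`) at level `j = 1`, every valid selection is forced class by class (`5, 6, 6, 7` on the pockets
`{0} ⊂ {0,1} ⊂ {0,1,2} ⊂ {0,1,2,3}`) and the four charges exceed `2 · μ(a light)` for every relay `a` (exact value `PI/maxR = 2.5980…`,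
`run/shared/lean/prim/prim-lf-6/CANDIDATES.md` §B9.5; ttrl2 re-verified the 11-vertex variant exactly; the same family gives `PI/maxR → r + 1`
with `r` carriers, so no k-uniform constant exists).  Method: the weighted-count machinery of `AdditiveGluing/Negative/CertWeighted.lean`
(`wsubs`, `wOfList`, `prodBernoulli_real_eq_wsum`) with Bool tests on the edge lists of the `2¹¹` sub-configurations (restricted reachability via
`reachTable` of the restricted list), one `native_decide`.  Computational certificate file (executable tests proved equivalent to the events); no sorries.
-/

namespace Summit.CriticalPhenomena.PercolationContinuityZ3.Theorems

open MeasureTheory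
open Literature.Probability.LatticeModels Literature.Probability.Percolation
open Summit.CriticalPhenomena.PercolationContinuityZ3.Theorems.AdditiveGluing.Negative.Cert
open scoped Classical

namespace PortSelectionTwoCex

/-! ### §1. Probabilities as weighted counts of tests on the sub-configuration edge lists -/

/-- **Any event is the weighted count of a Bool test on the edge lists of the sub-configurations**, provided the test
transcribes the event on every edge list. [this file] -/
theorem real_eq_wcountCfg {n : ℕ} {l : List (Fin n × Fin n × ℚ)} (hnd : (wPairs l).Nodup)
    (hq : ∀ e ∈ l, 0 ≤ e.2.2 ∧ e.2.2 ≤ 1) (f : List (Fin n × Fin n) → Bool) (D : Set (Set (Sym2 (Fin n))))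
    (hfD : ∀ ω : List (Fin n × Fin n), f ω = true ↔ (↑(Eset ω) : Set (Sym2 (Fin n))) ∈ D) :
    (prodBernoulli (wOfList l)).real D = ((((wsubs l).map fun c => if f c.1 then c.2 else 0).sum : ℚ) : ℝ) := by
  classical
  rw [prodBernoulli_real_eq_wsum hnd hq D, wsum, Rat.cast_list_sum, List.map_map]
  congr 1
  refine List.map_congr_left fun c _ => ?_
  simp only [Function.comp_apply]
  by_cases hD : (↑(Eset c.1) : Set (Sym2 (Fin n))) ∈ D
  · rw [if_pos hD, if_pos ((hfD c.1).2 hD), mul_one]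
  · rw [if_neg hD, if_neg (fun h => hD ((hfD c.1).1 h)), mul_zero, Rat.cast_zero]

/-! ### §2. Restricted reachability as a reach-table test -/

/-- The sub-list of pairs with both endpoints in `S`. [this file] -/
def restrictTo {n : ℕ} (S : Finset (Fin n)) (ω : List (Fin n × Fin n)) : List (Fin n × Fin n) :=
  ω.filter fun p => p.1 ∈ S ∧ p.2 ∈ S

/-- Adjacency in the restricted configuration. [this file] -/
theorem adj_restrictTo_iff {n : ℕ} (S : Finset (Fin n)) (ω : List (Fin n × Fin n)) (a b : Fin n) :
    (openGraph (↑(Eset (restrictTo S ω)) : Set (Sym2 (Fin n)))).Adj a b ↔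
      (openGraph (↑(Eset ω) : Set (Sym2 (Fin n)))).Adj a b ∧ a ∈ S ∧ b ∈ S := by
  simp only [openGraph_adj, Finset.mem_coe, mem_Eset_iff, restrictTo, List.mem_filter, decide_eq_true_eq]
  constructor
  · rintro ⟨⟨p, ⟨hp, hpS⟩, hpe⟩, hne⟩
    rcases hpe with rfl | rfl
    · exact ⟨⟨⟨_, hp, Or.inl rfl⟩, hne⟩, hpS.1, hpS.2⟩
    · exact ⟨⟨⟨_, hp, Or.inr rfl⟩, hne⟩, hpS.2, hpS.1⟩
  · rintro ⟨⟨⟨p, hp, hpe⟩, hne⟩, ha, hb⟩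
    rcases hpe with rfl | rfl
    · exact ⟨⟨(a, b), ⟨hp, ha, hb⟩, Or.inl rfl⟩, hne⟩
    · exact ⟨⟨(b, a), ⟨hp, hb, ha⟩, Or.inr rfl⟩, hne⟩

/-- **`{x ↔ y in S}` is reachability in the restricted configuration.** [this file] -/
theorem mem_openConnIn_iff_restrict {n : ℕ} (S : Finset (Fin n)) (ω : List (Fin n × Fin n)) (x y : Fin n) :
    (↑(Eset ω) : Set (Sym2 (Fin n))) ∈ openConnIn (↑S : Set (Fin n)) x y ↔
      x ∈ S ∧ y ∈ S ∧ (openGraph (↑(Eset (restrictTo S ω)) : Set (Sym2 (Fin n)))).Reachable x y := by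
  rw [DCT16.mem_openConnIn_iff_pathIn, PathIn, SimpleGraph.reachable_iff_reflTransGen]
  constructor
  · rintro ⟨hx, h⟩
    refine ⟨hx, ?_⟩
    induction h with
    | refl => exact ⟨hx, Relation.ReflTransGen.refl⟩
    | @tail b c _ hbc ih =>
      obtain ⟨hb, hreach⟩ := ih
      exact ⟨hbc.2, hreach.tail ((adj_restrictTo_iff S ω b c).2 ⟨hbc.1, hb, hbc.2⟩)⟩
  · rintro ⟨hx, -, h⟩
    refine ⟨hx, ?_⟩
    induction h with
    | refl => exact Relation.ReflTransGen.refl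
    | @tail b c _ hbc ih =>
      have h' := (adj_restrictTo_iff S ω b c).1 hbc
      exact ih.tail ⟨h'.1, h'.2.2⟩

/-- `{x ↔ y in S}` as a Bool test on the edge list. [this file] -/
theorem mem_openConnIn_iff_testBit {n : ℕ} (S : Finset (Fin n)) (ω : List (Fin n × Fin n)) (x y : Fin n) :
    (↑(Eset ω) : Set (Sym2 (Fin n))) ∈ openConnIn (↑S : Set (Fin n)) x y ↔
      x ∈ S ∧ y ∈ S ∧ ((reachTable n (restrictTo S ω)).getD x 0).testBit y = true := by
  rw [mem_openConnIn_iff_restrict, testBit_reachTable_iff_mem_openConn]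
  rfl

/-- `{x ↔ y}` as a Bool test on the edge list (restatement of `testBit_reachTable_iff_mem_openConn`). [this file] -/
theorem mem_openConn_iff_testBit {n : ℕ} (ω : List (Fin n × Fin n)) (x y : Fin n) :
    (↑(Eset ω) : Set (Sym2 (Fin n))) ∈ openConn x y ↔ ((reachTable n ω).getD x 0).testBit y = true :=
  (testBit_reachTable_iff_mem_openConn ω x y).symm

/-! ### §3. The witness: the alternating conduit chain on eight vertices -/

/-- The weighted edge list of the witness: observer `0`; Steiner path `0–1–2–3` (weights `9/10`); relay `4` glued to `1` and `3` (hub and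
blocker); pocket relay `5` glued to `0` with robustness edge `5–4 = 451/500`; carrier `6` glued to `2`, hair `6–1 = 1/1000`, robustness edge
`6–4 = 1/100`; loose port `7–3 = 99/100`. [this file] -/
def L : List (Fin 8 × Fin 8 × ℚ) :=
  [(0, 1, 9/10), (1, 2, 9/10), (2, 3, 9/10), (5, 0, 9999/10000), (5, 4, 451/500), (4, 1, 9999/10000), (4, 3, 9999/10000),
   (6, 2, 9999/10000), (6, 1, 1/1000), (6, 4, 1/100), (7, 3, 99/100)]

/-- The relays. [this file] -/
def Arel : Finset (Fin 8) := {4, 5, 6, 7}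

/-- The four realizable relay-free clusters of the observer (prefixes of the Steiner path). [this file] -/
def P0 : Finset (Fin 8) := {0}
/-- The pocket `{0,1}`. [this file] -/
def P1 : Finset (Fin 8) := {0, 1}
/-- The pocket `{0,1,2}`. [this file] -/
def P2 : Finset (Fin 8) := {0, 1, 2}
/-- The pocket `{0,1,2,3}`. [this file] -/
def P3 : Finset (Fin 8) := {0, 1, 2, 3}

/-- The pairs of `L` are distinct. [this file] -/
theorem L_nodup : (wPairs L).Nodup := by decide

/-- The weights of `L` lie in `[0, 1]`. [this file] -/
theorem L_weights : ∀ e ∈ L, 0 ≤ e.2.2 ∧ e.2.2 ≤ 1 := by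
  intro e he
  simp only [L, List.mem_cons, List.not_mem_nil, or_false] at he
  rcases he with rfl | rfl | rfl | rfl | rfl | rfl | rfl | rfl | rfl | rfl | rfl <;> norm_num

/-- The weighted count of a test on the sub-configurations of `L`. [this file] -/
def cnt (f : List (Fin 8 × Fin 8) → Bool) : ℚ := ((wsubs L).map fun c => if f c.1 then c.2 else 0).sum

/-- Every event is the weighted count of its transcription (`real_eq_wcountCfg` for `L`). [this file] -/
theorem real_eq_cnt (f : List (Fin 8 × Fin 8) → Bool) (D : Set (Set (Sym2 (Fin 8))))
    (hfD : ∀ ω : List (Fin 8 × Fin 8), f ω = true ↔ (↑(Eset ω) : Set (Sym2 (Fin 8))) ∈ D) :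
    (prodBernoulli (wOfList L)).real D = (cnt f : ℝ) :=
  real_eq_wcountCfg L_nodup L_weights f D hfD

/-- Test: 'relay `v` is `1`-light AVOIDING `V₀`' (at most one relay joined to `v` by open paths off `V₀`). [this file] -/
def tAvoid (V₀ : Finset (Fin 8)) (v : Fin 8) (ω : List (Fin 8 × Fin 8)) : Bool :=
  decide ((Arel.filter fun z => v ∈ V₀ᶜ ∧ z ∈ V₀ᶜ ∧ ((reachTable 8 (restrictTo V₀ᶜ ω)).getD v 0).testBit z.val = true).card ≤ 1)

/-- Test: 'relay `v` is `1`-light'. [this file] -/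
def tLight (v : Fin 8) (ω : List (Fin 8 × Fin 8)) : Bool :=
  decide ((Arel.filter fun z => ((reachTable 8 ω).getD v 0).testBit z.val = true).card ≤ 1)

/-- Test: 'the observer `0` is joined to some relay'. [this file] -/
def tObs (ω : List (Fin 8 × Fin 8)) : Bool :=
  decide (1 ≤ (Arel.filter fun z => ((reachTable 8 ω).getD 0 0).testBit z.val = true).card)

/-- Test: 'every vertex of `V₀` is joined to `0` inside `V₀`'. [this file] -/
def tBlobIn (V₀ : Finset (Fin 8)) (ω : List (Fin 8 × Fin 8)) : Bool :=
  decide (∀ u ∈ V₀, (0 : Fin 8) ∈ V₀ ∧ u ∈ V₀ ∧ ((reachTable 8 (restrictTo V₀ ω)).getD 0 0).testBit u.val = true)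

/-- Test: 'no open pair from `V₀` to a non-relay vertex outside `V₀`' (read on the pair list). [this file] -/
def tBlobClosed (V₀ : Finset (Fin 8)) (ω : List (Fin 8 × Fin 8)) : Bool :=
  decide (∀ u ∈ V₀, ∀ x : Fin 8, x ∉ V₀ → x ∉ Arel → ∀ p ∈ ω, ¬(p = (u, x) ∨ p = (x, u)))

/-- Test: the class term `{o ↔ A} ∩ {r light} ∩ Blob(V₀)`. [this file] -/
def tTerm (V₀ : Finset (Fin 8)) (r : Fin 8) (ω : List (Fin 8 × Fin 8)) : Bool :=
  tObs ω && tLight r ω && (tBlobIn V₀ ω && tBlobClosed V₀ ω)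

/-- `tAvoid` transcribes the avoiding-lightness event. [this file] -/
theorem tAvoid_iff (V₀ : Finset (Fin 8)) (v : Fin 8) (ω : List (Fin 8 × Fin 8)) :
    tAvoid V₀ v ω = true ↔ (↑(Eset ω) : Set (Sym2 (Fin 8))) ∈
      {η : Set (Sym2 (Fin 8)) | (Arel.filter fun z => η ∈ openConnIn ((↑V₀ : Set (Fin 8))ᶜ) v z).card ≤ 1} := by
  rw [tAvoid, decide_eq_true_eq, Set.mem_setOf_eq, ← Finset.coe_compl]
  simp_rw [mem_openConnIn_iff_testBit]

/-- `tLight` transcribes the lightness event. [this file] -/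
theorem tLight_iff (v : Fin 8) (ω : List (Fin 8 × Fin 8)) :
    tLight v ω = true ↔ (↑(Eset ω) : Set (Sym2 (Fin 8))) ∈
      {η : Set (Sym2 (Fin 8)) | (Arel.filter fun x => η ∈ openConn v x).card ≤ 1} := by
  rw [tLight, decide_eq_true_eq, Set.mem_setOf_eq]
  simp_rw [mem_openConn_iff_testBit]

/-- `tBlobClosed` transcribes the closed-boundary condition. [this file] -/
theorem tBlobClosed_iff (V₀ : Finset (Fin 8)) (ω : List (Fin 8 × Fin 8)) :
    tBlobClosed V₀ ω = true ↔ ∀ u ∈ V₀, ∀ x : Fin 8, x ∉ V₀ → x ∉ Arel → s(u, x) ∉ (↑(Eset ω) : Set (Sym2 (Fin 8))) := by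
  rw [tBlobClosed, decide_eq_true_eq]
  refine forall₂_congr fun u _ => forall_congr' fun x => forall_congr' fun _ => forall_congr' fun _ => ?_
  rw [Finset.mem_coe, mem_Eset_iff]
  simp only [not_exists, not_and]

/-- `tTerm` transcribes the class term event. [this file] -/
theorem tTerm_iff (V₀ : Finset (Fin 8)) (r : Fin 8) (ω : List (Fin 8 × Fin 8)) :
    tTerm V₀ r ω = true ↔ (↑(Eset ω) : Set (Sym2 (Fin 8))) ∈
      ({ω : Set (Sym2 (Fin 8)) | 1 ≤ (Arel.filter fun x => ω ∈ openConn (0 : Fin 8) x).card} ∩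
        {ω : Set (Sym2 (Fin 8)) | (Arel.filter fun x => ω ∈ openConn r x).card ≤ 1} ∩
        {ω : Set (Sym2 (Fin 8)) | (∀ u ∈ V₀, ω ∈ openConnIn (↑V₀ : Set (Fin 8)) 0 u) ∧
          ∀ u ∈ V₀, ∀ x, x ∉ V₀ → x ∉ Arel → s(u, x) ∉ ω}) := by
  rw [tTerm, Bool.and_eq_true, Bool.and_eq_true, Bool.and_eq_true, tBlobClosed_iff, tLight_iff, tObs, tBlobIn,
    decide_eq_true_eq, decide_eq_true_eq, Set.mem_inter_iff, Set.mem_inter_iff, Set.mem_setOf_eq, Set.mem_setOf_eq, Set.mem_setOf_eq]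
  simp_rw [mem_openConn_iff_testBit, mem_openConnIn_iff_testBit, Fin.val_zero]

/-! ### §4. The exact comparisons (decided natively over the 2¹¹ weighted sub-configurations) -/

/-- **The numerical certificate.**  In each of the four pocket classes the Kozma–Nitzan-valid choice is UNIQUE (every other relay is
strictly less fragile avoiding the pocket than the port `5` / `6` / `6` / `7`), and the four resulting charges add up to MORE than twice the
lightness probability of every relay. [this file] -/
theorem facts :
    (max (cnt (tAvoid P0 4)) (max (cnt (tAvoid P0 6)) (cnt (tAvoid P0 7))) < cnt (tAvoid P0 5)) ∧
    (max (cnt (tAvoid P1 4)) (max (cnt (tAvoid P1 5)) (cnt (tAvoid P1 7))) < cnt (tAvoid P1 6)) ∧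
    (max (cnt (tAvoid P2 4)) (max (cnt (tAvoid P2 5)) (cnt (tAvoid P2 7))) < cnt (tAvoid P2 6)) ∧
    (max (cnt (tAvoid P3 4)) (max (cnt (tAvoid P3 5)) (cnt (tAvoid P3 6))) < cnt (tAvoid P3 7)) ∧
    (2 * max (max (cnt (tLight 4)) (cnt (tLight 5))) (max (cnt (tLight 6)) (cnt (tLight 7))) <
      cnt (tTerm P0 5) + cnt (tTerm P1 6) + cnt (tTerm P2 6) + cnt (tTerm P3 7)) := by
  native_decide

/-! ### §5. The refutation -/

/-- Membership in the relay set. [this file] -/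
theorem mem_Arel (a : Fin 8) : a ∈ Arel ↔ a = 4 ∨ a = 5 ∨ a = 6 ∨ a = 7 := by
  simp only [Arel, Finset.mem_insert, Finset.mem_singleton]

/-- A listed pair has non-zero weight: the port hairs/edges used in the validity hypotheses. [this file] -/
theorem w_ne_zero_50 : wOfList L s(0, 5) ≠ 0 := by
  intro h; have h' := congrArg (fun u : unitInterval => (u : ℝ)) h; simp [wOfList, mkE, L] at h'; norm_num at h'
/-- see `w_ne_zero_50`. [this file] -/
theorem w_ne_zero_16 : wOfList L s(1, 6) ≠ 0 := by
  intro h; have h' := congrArg (fun u : unitInterval => (u : ℝ)) h; simp [wOfList, mkE, L] at h'; norm_num at h'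
/-- see `w_ne_zero_50`. [this file] -/
theorem w_ne_zero_26 : wOfList L s(2, 6) ≠ 0 := by
  intro h; have h' := congrArg (fun u : unitInterval => (u : ℝ)) h; simp [wOfList, mkE, L] at h'; norm_num at h'
/-- see `w_ne_zero_50`. [this file] -/
theorem w_ne_zero_37 : wOfList L s(3, 7) ≠ 0 := by
  intro h; have h' := congrArg (fun u : unitInterval => (u : ℝ)) h; simp [wOfList, mkE, L] at h'; norm_num at h'

/-- **Pinning lemma.**  If a choice `r ∈ A` is at least as fragile avoiding `V₀` as the port `v`, while every relay other than `v` is strictly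
less fragile than `v` (the `facts`), then `r = v`. [this file] -/
theorem pin {V₀ : Finset (Fin 8)} {v r : Fin 8} (hr : r ∈ Arel)
    (hle : (cnt (tAvoid V₀ v) : ℝ) ≤ cnt (tAvoid V₀ r))
    (hlt : ∀ s ∈ Arel, s ≠ v → cnt (tAvoid V₀ s) < cnt (tAvoid V₀ v)) : r = v := by
  by_contra hne
  have h := hlt r hr hne
  exact absurd hle (not_le.2 (by exact_mod_cast h))

/-- **The port-selection bound with constant `2` is FALSE** (hence so are PI(2), SEL-level(2) and TOP2 of lemma factory #6 / the lead's (SEL)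
diagnostic with a constant): the hypothesis of `noHeavyLowerTail_of_portSelection` at `C = 2` — for every graph a Kozma–Nitzan-valid selection
`c` and a relay `a` with `Σ_{V₀} μ(o ↔ A ∧ c(V₀) light ∧ Blob V₀) ≤ 2·μ(a light)` — fails on the eight-vertex alternating conduit chain `L` at
level `j = 1`: validity forces `c{0} = 5`, `c{0,1} = 6`, `c{0,1,2} = 6`, `c{0,1,2,3} = 7`, and these four classes alone charge more than
`2·μ(a light)` for every relay `a` (`≈ 2.598·maxR`).  [this work; witness CANDIDATES §B9.5, exact re-verification ttrl2 lf6/PI.md] -/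
theorem portSelection_two_false : ¬ (∀ (n : ℕ) (w : Sym2 (Fin n) → unitInterval) (A : Finset (Fin n)) (o : Fin n) (j : ℕ),
      A.Nonempty → o ∉ A → ∃ c : Finset (Fin n) → Fin n,
        (∀ V₀ : Finset (Fin n), o ∈ V₀ → Disjoint V₀ A → c V₀ ∈ A ∧
          ∀ v ∈ A, (∃ u ∈ V₀, w s(u, v) ≠ 0) →
            (Literature.Probability.LatticeModels.prodBernoulli w).real
                {ω : Literature.Probability.Percolation.BondConfig (Fin n) |
                  (A.filter fun z => ω ∈ Literature.Probability.Percolation.openConnIn ((↑V₀ : Set (Fin n))ᶜ) v z).card ≤ j} ≤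
              (Literature.Probability.LatticeModels.prodBernoulli w).real
                {ω : Literature.Probability.Percolation.BondConfig (Fin n) |
                  (A.filter fun z => ω ∈ Literature.Probability.Percolation.openConnIn ((↑V₀ : Set (Fin n))ᶜ) (c V₀) z).card ≤ j}) ∧
        ∃ a ∈ A,
          ∑ V₀ ∈ (Finset.univ : Finset (Finset (Fin n))).filter (fun V₀ => o ∈ V₀ ∧ Disjoint V₀ A),
            (Literature.Probability.LatticeModels.prodBernoulli w).real
              ({ω : Literature.Probability.Percolation.BondConfig (Fin n) |
                  1 ≤ (A.filter fun x => ω ∈ Literature.Probability.Percolation.openConn o x).card} ∩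
                {ω : Literature.Probability.Percolation.BondConfig (Fin n) |
                  (A.filter fun x => ω ∈ Literature.Probability.Percolation.openConn (c V₀) x).card ≤ j} ∩
                {ω : Literature.Probability.Percolation.BondConfig (Fin n) |
                  (∀ u ∈ V₀, ω ∈ Literature.Probability.Percolation.openConnIn (↑V₀ : Set (Fin n)) o u) ∧
                    ∀ u ∈ V₀, ∀ x, x ∉ V₀ → x ∉ A → s(u, x) ∉ ω}) ≤
          2 * (Literature.Probability.LatticeModels.prodBernoulli w).real
              {ω : Literature.Probability.Percolation.BondConfig (Fin n) |
                (A.filter fun x => ω ∈ Literature.Probability.Percolation.openConn a x).card ≤ j}) := by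
  intro h
  obtain ⟨c, hc, a, ha, hsum⟩ := h 8 (wOfList L) Arel 0 1 ⟨4, by decide⟩ (by decide)
  obtain ⟨f0, f1, f2, f3, fsum⟩ := facts
  have lt_of_max3 : ∀ {x y z t : ℚ}, max x (max y z) < t → x < t ∧ y < t ∧ z < t := fun h =>
    ⟨lt_of_le_of_lt (le_max_left _ _) h, lt_of_le_of_lt ((le_max_left _ _).trans (le_max_right _ _)) h,
      lt_of_le_of_lt ((le_max_right _ _).trans (le_max_right _ _)) h⟩
  have hval : ∀ (V₀ : Finset (Fin 8)) (v : Fin 8), (0 : Fin 8) ∈ V₀ → Disjoint V₀ Arel → v ∈ Arel →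
      (∃ u ∈ V₀, wOfList L s(u, v) ≠ 0) → c V₀ ∈ Arel ∧ (cnt (tAvoid V₀ v) : ℝ) ≤ cnt (tAvoid V₀ (c V₀)) := by
    intro V₀ v ho hd hv hu
    obtain ⟨hcA, hle⟩ := hc V₀ ho hd
    have h' := hle v hv hu
    rw [real_eq_cnt _ _ (tAvoid_iff V₀ v), real_eq_cnt _ _ (tAvoid_iff V₀ (c V₀))] at h'
    exact ⟨hcA, h'⟩
  have h0 : c P0 = 5 := by
    obtain ⟨hcA, hle⟩ := hval P0 5 (by decide) (by decide) (by decide) ⟨0, by decide, by rw [Sym2.eq_swap]; exact w_ne_zero_50⟩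
    obtain ⟨l4, l6, l7⟩ := lt_of_max3 f0
    refine pin hcA hle fun s hs hne => ?_
    rcases (mem_Arel s).1 hs with rfl | rfl | rfl | rfl
    · exact l4
    · exact absurd rfl hne
    · exact l6
    · exact l7
  have h1 : c P1 = 6 := by
    obtain ⟨hcA, hle⟩ := hval P1 6 (by decide) (by decide) (by decide) ⟨1, by decide, w_ne_zero_16⟩
    obtain ⟨l4, l5, l7⟩ := lt_of_max3 f1
    refine pin hcA hle fun s hs hne => ?_
    rcases (mem_Arel s).1 hs with rfl | rfl | rfl | rfl
    · exact l4
    · exact l5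
    · exact absurd rfl hne
    · exact l7
  have h2 : c P2 = 6 := by
    obtain ⟨hcA, hle⟩ := hval P2 6 (by decide) (by decide) (by decide) ⟨2, by decide, w_ne_zero_26⟩
    obtain ⟨l4, l5, l7⟩ := lt_of_max3 f2
    refine pin hcA hle fun s hs hne => ?_
    rcases (mem_Arel s).1 hs with rfl | rfl | rfl | rfl
    · exact l4
    · exact l5
    · exact absurd rfl hne
    · exact l7
  have h3 : c P3 = 7 := by
    obtain ⟨hcA, hle⟩ := hval P3 7 (by decide) (by decide) (by decide) ⟨3, by decide, w_ne_zero_37⟩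
    obtain ⟨l4, l5, l6⟩ := lt_of_max3 f3
    refine pin hcA hle fun s hs hne => ?_
    rcases (mem_Arel s).1 hs with rfl | rfl | rfl | rfl
    · exact l4
    · exact l5
    · exact l6
    · exact absurd rfl hne
  set T : Finset (Fin 8) → ℝ := fun V₀ => (prodBernoulli (wOfList L)).real
      ({ω : BondConfig (Fin 8) | 1 ≤ (Arel.filter fun x => ω ∈ openConn (0 : Fin 8) x).card} ∩
        {ω : BondConfig (Fin 8) | (Arel.filter fun x => ω ∈ openConn (c V₀) x).card ≤ 1} ∩
        {ω : BondConfig (Fin 8) | (∀ u ∈ V₀, ω ∈ openConnIn (↑V₀ : Set (Fin 8)) 0 u) ∧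
          ∀ u ∈ V₀, ∀ x, x ∉ V₀ → x ∉ Arel → s(u, x) ∉ ω}) with hT
  have hsub : ({P0, P1, P2, P3} : Finset (Finset (Fin 8))) ⊆
      (Finset.univ : Finset (Finset (Fin 8))).filter (fun V₀ => (0 : Fin 8) ∈ V₀ ∧ Disjoint V₀ Arel) := by
    intro V hV
    simp only [Finset.mem_insert, Finset.mem_singleton] at hV
    rw [Finset.mem_filter]
    rcases hV with rfl | rfl | rfl | rfl <;> exact ⟨Finset.mem_univ _, by decide, by decide⟩
  have hge : T P0 + T P1 + T P2 + T P3 ≤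
      ∑ V₀ ∈ (Finset.univ : Finset (Finset (Fin 8))).filter (fun V₀ => (0 : Fin 8) ∈ V₀ ∧ Disjoint V₀ Arel), T V₀ := by
    have h4 : ∑ V₀ ∈ ({P0, P1, P2, P3} : Finset (Finset (Fin 8))), T V₀ = T P0 + T P1 + T P2 + T P3 := by
      rw [Finset.sum_insert (by decide), Finset.sum_insert (by decide), Finset.sum_insert (by decide), Finset.sum_singleton]
      ring
    rw [← h4]
    exact Finset.sum_le_sum_of_subset_of_nonneg hsub fun V₀ _ _ => measureReal_nonneg
  have e0 : T P0 = cnt (tTerm P0 5) := by rw [hT]; simp only []; rw [h0]; exact real_eq_cnt _ _ (tTerm_iff P0 5)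
  have e1 : T P1 = cnt (tTerm P1 6) := by rw [hT]; simp only []; rw [h1]; exact real_eq_cnt _ _ (tTerm_iff P1 6)
  have e2 : T P2 = cnt (tTerm P2 6) := by rw [hT]; simp only []; rw [h2]; exact real_eq_cnt _ _ (tTerm_iff P2 6)
  have e3 : T P3 = cnt (tTerm P3 7) := by rw [hT]; simp only []; rw [h3]; exact real_eq_cnt _ _ (tTerm_iff P3 7)
  rw [e0, e1, e2, e3] at hge
  have htot := hge.trans hsum
  rw [real_eq_cnt _ _ (tLight_iff a)] at htot
  have hlt : 2 * cnt (tLight a) < cnt (tTerm P0 5) + cnt (tTerm P1 6) + cnt (tTerm P2 6) + cnt (tTerm P3 7) := by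
    refine lt_of_le_of_lt ?_ fsum
    refine mul_le_mul_of_nonneg_left ?_ (by norm_num)
    rcases (mem_Arel a).1 ha with rfl | rfl | rfl | rfl
    · exact (le_max_left _ _).trans (le_max_left _ _)
    · exact (le_max_right _ _).trans (le_max_left _ _)
    · exact (le_max_left _ _).trans (le_max_right _ _)
    · exact (le_max_right _ _).trans (le_max_right _ _)
  have hlt' : (2 * cnt (tLight a) : ℝ) < (cnt (tTerm P0 5) + cnt (tTerm P1 6) + cnt (tTerm P2 6) + cnt (tTerm P3 7) : ℝ) := by
    exact_mod_cast hlt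
  linarith

/-- **Corollary: the TOP2 hypothesis is FALSE as well** — the hypothesis of `noHeavyLowerTail_of_topTwoSelection` (a valid selection whose selected
relay is light, with the observer attached, no more often than two relays `a, b` together) implies the `C = 2` port-selection bound refuted by
`portSelection_two_false` (the larger of `μ(a light)`, `μ(b light)` carries the constant `2`). [this work] -/
theorem topTwoSelection_false : ¬ (∀ (n : ℕ) (w : Sym2 (Fin n) → unitInterval) (A : Finset (Fin n)) (o : Fin n) (j : ℕ),
      A.Nonempty → o ∉ A → ∃ c : Finset (Fin n) → Fin n,
        (∀ V₀ : Finset (Fin n), o ∈ V₀ → Disjoint V₀ A → c V₀ ∈ A ∧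
          ∀ v ∈ A, (∃ u ∈ V₀, w s(u, v) ≠ 0) →
            (Literature.Probability.LatticeModels.prodBernoulli w).real
                {ω : Literature.Probability.Percolation.BondConfig (Fin n) |
                  (A.filter fun z => ω ∈ Literature.Probability.Percolation.openConnIn ((↑V₀ : Set (Fin n))ᶜ) v z).card ≤ j} ≤
              (Literature.Probability.LatticeModels.prodBernoulli w).real
                {ω : Literature.Probability.Percolation.BondConfig (Fin n) |
                  (A.filter fun z => ω ∈ Literature.Probability.Percolation.openConnIn ((↑V₀ : Set (Fin n))ᶜ) (c V₀) z).card ≤ j}) ∧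
        ∃ a ∈ A, ∃ b ∈ A,
          ∑ V₀ ∈ (Finset.univ : Finset (Finset (Fin n))).filter (fun V₀ => o ∈ V₀ ∧ Disjoint V₀ A),
            (Literature.Probability.LatticeModels.prodBernoulli w).real
              ({ω : Literature.Probability.Percolation.BondConfig (Fin n) |
                  1 ≤ (A.filter fun x => ω ∈ Literature.Probability.Percolation.openConn o x).card} ∩
                {ω : Literature.Probability.Percolation.BondConfig (Fin n) |
                  (A.filter fun x => ω ∈ Literature.Probability.Percolation.openConn (c V₀) x).card ≤ j} ∩
                {ω : Literature.Probability.Percolation.BondConfig (Fin n) |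
                  (∀ u ∈ V₀, ω ∈ Literature.Probability.Percolation.openConnIn (↑V₀ : Set (Fin n)) o u) ∧
                    ∀ u ∈ V₀, ∀ x, x ∉ V₀ → x ∉ A → s(u, x) ∉ ω}) ≤
          (Literature.Probability.LatticeModels.prodBernoulli w).real
              {ω : Literature.Probability.Percolation.BondConfig (Fin n) |
                (A.filter fun x => ω ∈ Literature.Probability.Percolation.openConn a x).card ≤ j} +
            (Literature.Probability.LatticeModels.prodBernoulli w).real
              {ω : Literature.Probability.Percolation.BondConfig (Fin n) |
                (A.filter fun x => ω ∈ Literature.Probability.Percolation.openConn b x).card ≤ j}) := by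
  intro h
  refine portSelection_two_false fun n w A o j hA hoA => ?_
  obtain ⟨c, hc, a, ha, b, hb, hsum⟩ := h n w A o j hA hoA
  refine ⟨c, hc, ?_⟩
  by_cases hab :
      (prodBernoulli w).real {ω : BondConfig (Fin n) | (A.filter fun x => ω ∈ openConn b x).card ≤ j} ≤
        (prodBernoulli w).real {ω : BondConfig (Fin n) | (A.filter fun x => ω ∈ openConn a x).card ≤ j}
  · exact ⟨a, ha, hsum.trans (by linarith)⟩
  · push Not at hab
    exact ⟨b, hb, hsum.trans (by linarith)⟩

end PortSelectionTwoCex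

end Summit.CriticalPhenomena.PercolationContinuityZ3.Theorems
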